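import Literature.AlgebraicGeometry.AbelianSchemes.AbelianSchemeOverIsogenyFinite
import Literature.AlgebraicGeometry.AbelianSchemes.AbelianSchemeOverMulNFiniteFlat
import HarnessLib

/-!
# A quasi-inverse pair of homomorphisms of abelian schemes (`φ ψ = [N]`, `ψ φ = [N]`, `N ≠ 0`) consists of isogenies

Topic `AlgebraicGeometry/AbelianSchemes`, namespace `Literature.AlgebraicGeometry.AbelianSchemes.AbelianSchemeOver` (THEOREMS ONLY; no
definition, no named fact, no `sorry`, no `instance`, no notation; any base `S`, any characteristic).  Cell `hodgecm-mathlib`, F0/P6 «MOD»,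
P6a organ (g2) FILE 14 — the geometric half behind «`𝔞 ⊂ 𝔟` of finite index ⇒ `A ⊗_𝒪 𝔞 → A ⊗_𝒪 𝔟` is an isogeny» (the formal half
is FILE 13 `SerreTensorQuasiInverse`); `--supports stmt-HodgeConjecture-24832`, count-neutral.  HC_CM is proved only modulo the 2
remaining named inputs (hLiu418, h413) until rung 0 closes; this file discharges none of them.

## Mathematics

Let `φ : A → B`, `ψ : B → A` be homomorphisms of abelian schemes over `S` with `ψ ∘ φ = [N]_A` and `φ ∘ ψ = [N]_B` for an integer
`N ≠ 0`.  On every field-valued fibre, `[N]` is finite and surjective ([GortzWedhorn2023] Prop. 27.186, any characteristic — ★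
`AbelianSchemeOverMulNFiniteFlat`), so `φ_t` is surjective (a right factor of the surjective `[N]_{B_t} = φ_t ∘ ψ_t`) and finite
(a left factor of the finite `[N]_{A_t} = ψ_t ∘ φ_t`, `ψ_t` separated): `φ_t` is an ISOGENY of abelian varieties for every `t`
([GortzWedhorn2023] Def. 27.176), and symmetrically `ψ_t`.  By ★ `AbelianSchemeOverIsogenyFinite` ∕ ★ `PolarizationLamEtale`
([GortzWedhorn2023] Cor. 27.177 (1)) `φ` is then finite, flat and surjective with finite locally free kernel.  No dimension hypothesis
and no invertibility of `N` in the residue fields is needed (contrast ★ `AbelianVariety.isIsogeny_of_comp_eq_nsmul_id`).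

## Contents

* `isIsogeny_fibreHom_of_quasiInverse` (every field-valued fibre `φ_t` is an isogeny), `isIsogeny_fibreHom_of_quasiInverse'` (`ψ_t`);
* **`isFinite_left_of_quasiInverse`**, **`flat_left_of_quasiInverse`**, **`surjective_left_of_quasiInverse`**,
  `isFinite_fst_unit_of_quasiInverse`, `flat_fst_unit_of_quasiInverse` (`Ker φ → S` finite locally free).

## References
* [GortzWedhorn2023] U. Görtz, T. Wedhorn, *Algebraic Geometry II* (2023), Def. 27.176, Cor. 27.177 (1), Prop. 27.186.
* [MumfordAV1970] D. Mumford, *Abelian Varieties* (1970), §6 Application 3 (p. 64), §19 Remark (p. 169).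
* [Conrad2004GrossZagier] B. Conrad, *Gross–Zagier revisited* (2004), §7 (proof of Thm. 7.5, where this is applied to `M ⊗ A → N ⊗ A`).
-/

noncomputable section

universe u

open CategoryTheory CategoryTheory.Limits AlgebraicGeometry MonoidalCategory

namespace Literature.AlgebraicGeometry.AbelianSchemes

namespace AbelianSchemeOver

open scoped MonObj
open Literature.AlgebraicGeometry.Motives (AbelianVariety)

variable {S : Scheme.{u}} {A B : AbelianSchemeOver S} (φ : A.X ⟶ B.X) (ψ : B.X ⟶ A.X) [IsMonHom φ] {N : ℕ}

/-- The scheme map of `φ_t` is `(Over.pullback t).map φ` (★ `fibreHom_hom_hom_hom`). [cite: GortzWedhorn2020, Section (4.7) (p. 135)] -/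
private theorem toSchemeHom_fibreHom_eq {Ω : Type u} [Field Ω] (t : Spec (.of Ω) ⟶ S) :
    AbelianVariety.Hom.toSchemeHom (fibreHom φ t) = ((Over.pullback t).map φ).left := rfl

/-- **Every fibre of a quasi-inverse pair is an isogeny**: `ψ φ = [N]_A`, `φ ψ = [N]_B`, `N ≠ 0` ⇒ `φ_t` is an isogeny of abelian
varieties for every field-valued point `t` (any characteristic). [cite: GortzWedhorn2023, Def. 27.176 and Prop. 27.186]
[cite: MumfordAV1970, §19 Remark p. 169] -/
theorem isIsogeny_fibreHom_of_quasiInverse (hN : N ≠ 0) (hφψ : φ ≫ ψ = (𝟙 A.X : A.X ⟶ A.X) ^ N)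
    (hψφ : ψ ≫ φ = (𝟙 B.X : B.X ⟶ B.X) ^ N) {Ω : Type u} [Field Ω] (t : Spec (.of Ω) ⟶ S) :
    AbelianVariety.IsIsogeny (fibreHom φ t) := by
  rw [AbelianVariety.IsIsogeny, toSchemeHom_fibreHom_eq]
  constructor
  · have hs := B.surjective_pullback_map_pow_id_of_ne_zero t hN
    rw [← hψφ, Functor.map_comp, Over.comp_left] at hs
    exact @Surjective.of_comp _ _ _ _ _ hs
  · have hf := A.isFinite_pullback_map_pow_id_of_ne_zero t hN
    rw [← hφψ, Functor.map_comp, Over.comp_left] at hf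
    haveI : IsProper ((Over.pullback t).map ψ).left := isProper_hom_left (A := B.baseChange t) (B := A.baseChange t) _
    exact IsFinite.of_comp ((Over.pullback t).map φ).left ((Over.pullback t).map ψ).left

omit [IsMonHom φ] in
/-- Symmetrically, `ψ_t` is an isogeny. [cite: GortzWedhorn2023, Def. 27.176 and Prop. 27.186] -/
theorem isIsogeny_fibreHom_of_quasiInverse' [IsMonHom ψ] (hN : N ≠ 0) (hφψ : φ ≫ ψ = (𝟙 A.X : A.X ⟶ A.X) ^ N)
    (hψφ : ψ ≫ φ = (𝟙 B.X : B.X ⟶ B.X) ^ N) {Ω : Type u} [Field Ω] (t : Spec (.of Ω) ⟶ S) :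
    AbelianVariety.IsIsogeny (fibreHom ψ t) :=
  isIsogeny_fibreHom_of_quasiInverse ψ φ hN hψφ hφψ t

/-- **`φ` is FINITE.** [cite: GortzWedhorn2023, Cor. 27.177 (1)] -/
theorem isFinite_left_of_quasiInverse (hN : N ≠ 0) (hφψ : φ ≫ ψ = (𝟙 A.X : A.X ⟶ A.X) ^ N)
    (hψφ : ψ ≫ φ = (𝟙 B.X : B.X ⟶ B.X) ^ N) : IsFinite φ.left :=
  isFinite_left_of_isIsogeny_fibreHom φ fun _ _ _ t => isIsogeny_fibreHom_of_quasiInverse φ ψ hN hφψ hψφ t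

/-- **`φ` is FLAT.** [cite: GortzWedhorn2023, Cor. 27.177 (1)] -/
theorem flat_left_of_quasiInverse (hN : N ≠ 0) (hφψ : φ ≫ ψ = (𝟙 A.X : A.X ⟶ A.X) ^ N)
    (hψφ : ψ ≫ φ = (𝟙 B.X : B.X ⟶ B.X) ^ N) : Flat φ.left :=
  flat_left_of_isIsogeny_fibreHom φ fun _ _ _ t => isIsogeny_fibreHom_of_quasiInverse φ ψ hN hφψ hψφ t

/-- **`φ` is SURJECTIVE.** [cite: GortzWedhorn2023, Cor. 27.177 (1)] -/
theorem surjective_left_of_quasiInverse (hN : N ≠ 0) (hφψ : φ ≫ ψ = (𝟙 A.X : A.X ⟶ A.X) ^ N)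
    (hψφ : ψ ≫ φ = (𝟙 B.X : B.X ⟶ B.X) ^ N) : Surjective φ.left :=
  surjective_left_of_isIsogeny_fibreHom φ fun _ _ _ t => isIsogeny_fibreHom_of_quasiInverse φ ψ hN hφψ hψφ t

/-- **`Ker φ → S` is FINITE.** [cite: GortzWedhorn2023, Cor. 27.177 (1)] -/
theorem isFinite_fst_unit_of_quasiInverse (hN : N ≠ 0) (hφψ : φ ≫ ψ = (𝟙 A.X : A.X ⟶ A.X) ^ N)
    (hψφ : ψ ≫ φ = (𝟙 B.X : B.X ⟶ B.X) ^ N) : IsFinite (pullback.fst (η[B.X] : 𝟙_ (Over S) ⟶ B.X).left φ.left) :=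
  isFinite_fst_unit_of_isIsogeny_fibreHom φ fun _ _ _ t => isIsogeny_fibreHom_of_quasiInverse φ ψ hN hφψ hψφ t

/-- **`Ker φ → S` is FLAT** (so finite locally free). [cite: GortzWedhorn2023, Cor. 27.177 (1)] -/
theorem flat_fst_unit_of_quasiInverse (hN : N ≠ 0) (hφψ : φ ≫ ψ = (𝟙 A.X : A.X ⟶ A.X) ^ N)
    (hψφ : ψ ≫ φ = (𝟙 B.X : B.X ⟶ B.X) ^ N) : Flat (pullback.fst (η[B.X] : 𝟙_ (Over S) ⟶ B.X).left φ.left) :=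
  flat_fst_unit_of_isIsogeny_fibreHom φ fun _ _ _ t => isIsogeny_fibreHom_of_quasiInverse φ ψ hN hφψ hψφ t

end AbelianSchemeOver

end Literature.AlgebraicGeometry.AbelianSchemes

end
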